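import Literature.NumberTheory.EllipticCurves.ProfiniteGroupDistributionGlueIntegral
import Literature.NumberTheory.EllipticCurves.ProfiniteGroupDistributionInduceFromSubgroup
import HarnessLib

/-!
# Bounded distributions on a group along a subgroup tower, XVII: the INTEGRALS of the two-variable
# glued measure READ AT ANY MODULUS — `∫_𝒢 χ dE = (χ(σ_𝔠) − N𝔠)⁻¹ ∫ χ dμ_𝔠^{(m)}`, and, for an induced
# family, `= (χ(σ_𝔠) − N𝔠)⁻¹ Σ_{c ∈ 𝒢/U^{(m)}_0} χ(r_c) ∫_{H_m} χ d i_{H_m}(r_c⁻¹ • β_𝔠^{(m)})`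
# (de Shalit 1987, II.4.14 (38) first line, with II.4.12 (29)↔(31) and II.4.7 (16))

Topic `NumberTheory/EllipticCurves`; namespace `Literature.NumberTheory.EllipticCurves.GroupDistribution`.

De Shalit, *Iwasawa theory of elliptic curves with complex multiplication* (1987), II.4.14, proof of
(38) (p. 71–72): the moments of the glued measure `μ_𝔞` on `𝒢 = Gal(K(𝔤p^∞)/K)` against a character
`ε` factoring through `Gal(K(𝔤𝔭̄^m𝔭^∞)/K)` are computed AT THE FIXED MODULUS `𝔣 = 𝔤𝔭̄^m`:
"`Ω_p^{-k} ∫_𝒢 ε(σ) dμ_𝔞(σ) = (N𝔞 − ε(σ_𝔞)) · …`", the right-hand side being the one-modulus value of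
II.4.12 (29)↔(31) (`μ_𝔠 = (σ_𝔠 − N𝔠)μ(𝔣)`, p. 67–69) decomposed over `Gal(K(𝔣)/K) = 𝒢/G` by II.4.7 (16)
(p. 60): "`∫_𝒢 χφ^k dμ⁰_β = Σ_𝔠 χφ^k(𝔠⁻¹) · ∫_G φ^k dμ⁰_{σ_𝔠(β)}`".

`ProfiniteGroupDistributionTwoVariableAssembly.lean` produced the glued two-variable `E` along the
DIAGONAL tower of a refining sequence `𝒰^{(m)}` with `δ_{σ_𝔠,N𝔠} E = μ_𝔠^{(n)}` at every level `n`
(`μ_𝔠^{(m)} = i_m(β_𝔠^{(m)})`) and `integral_eq_of_glue` (`∫ χ dE = (χ(σ_𝔠) − N𝔠)⁻¹ ∫ χ d(glue μ_𝔠)`);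
`ProfiniteGroupDistributionGlueIntegral.lean` computed `∫ f d(glue μ) = ∫ f dμ^{(m)}` for `f` continuous
for the `m`-th tower; `ProfiniteGroupDistributionInduceFromSubgroup.lean` decomposed the integrals of an
INDUCED measure `induceFrom i_H` over the cosets of `U_0` (II.4.7 (16)).  THIS file CHAINS the three —
the form in which the two-variable measure is actually USED (every character of finite level is
continuous for SOME `𝒰^{(m)}`):

* §1 ★ `integral_eq_of_glue_at` — for a generic family `i : ∀ m, B_m → Λ(𝒢 along 𝒰^{(m)})`:
  **`∫_𝒢 χ dE = (χ(σ_𝔠) − N𝔠)⁻¹ · ∫_𝒢 χ d i_m(β_𝔠^{(m)})`** for every `m` and every multiplicative `χ`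
  with `χ(1) = 1`, continuous for `𝒰^{(m)}`, `χ(σ_𝔠) ≠ N𝔠`;
* §2 ★★ `integral_eq_sum_of_glue_induceFrom` / `…_of_le` — for `i_m = induceFrom i_{H_m}` induced from
  subgroups `H_m ⊇ U^{(m)}_0` (de Shalit's `G = Gal(F_∞/F)`, `F = K(𝔣_m)`):
  **`∫_𝒢 χ dE = (χ(σ_𝔠) − N𝔠)⁻¹ · Σ_{c ∈ 𝒢/U^{(m)}_0} χ(r_c) · ∫_{H_m} 𝟙_{U^{(m)}_0} χ d i_{H_m}(r_c⁻¹ • β_𝔠^{(m)})`**,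
  indicator-free when `H_m = U^{(m)}_0` (the case `[K(𝔣_m v) : K(𝔣_m)] = 1`, e.g. a degree-one `v ∣ 2`).

What is NOT here: the number-field instantiation (cell `bsd-print-cf2`, `…Theorems.PrintCf2.EllipticUnits*`)
and the evaluation of the local integrals (II.4.7–4.10).  Everything is a theorem; no named facts, no
instances, no `sorry`.

## References

* [deShalit1987] E. de Shalit, *Iwasawa theory of elliptic curves with complex multiplication* (1987),
  II.4.14 (38) and Step 1 (p. 71–72), II.4.12 (29)–(31) (p. 66–69), II.4.7 (16) (p. 60), I.3.4 (p. 18).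
-/

noncomputable section

open Filter
open scoped Topology Classical

namespace Literature.NumberTheory.EllipticCurves

namespace GroupDistribution

open TwistingDiv

variable {p : ℕ} [hp : Fact p.Prime]
variable {G : Type*} [Group G] {𝒰 : ℕ → SubgroupTower G}
  {href : ∀ m n, (𝒰 (m + 1)).U n ≤ (𝒰 m).U n} [∀ m n, ((𝒰 m).U n).Normal]
variable {B : ℕ → Type*} {I : Type*}

/-! ### §1. The integrals of the glued two-variable measure, read at the modulus `𝔣_m` -/

/-- ★ **The integrals of the two-variable measure READ AT ANY MODULUS** (II.4.14 (38), first line, with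
(29)↔(31)): if `δ_{σ_𝔠,N𝔠} E = μ_𝔠^{(n)} = i_n(β_𝔠^{(n)})` at every level `n` of the diagonal tower and the
`μ_𝔠^{(m)}` are compatible under coarsening, then for every `m` and every multiplicative `χ : 𝒢 → ℂ_p`
with `χ(1) = 1`, continuous for the `m`-th tower `𝒰^{(m)}` and with `χ(σ_𝔠) ≠ N𝔠`,
**`∫_𝒢 χ dE = (χ(σ_𝔠) − N𝔠)⁻¹ · ∫_𝒢 χ dμ_𝔠^{(m)}`** (`integral_eq_of_glue`, then `integral_glue_eq`:
the glued `μ_𝔠` integrates `𝒰^{(m)}`-continuous functions like `μ_𝔠^{(m)}`).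
[cite: deShalit1987, II.4.14 (38) (p. 71–72), II.4.12 (29)↔(31) (p. 67–69)] -/
theorem integral_eq_of_glue_at (i : (m : ℕ) → B m → GroupDistribution (𝒰 m) ℂ_[p])
    (β : (m : ℕ) → I → B m) (σ : I → G) (Nm : I → ℕ)
    (E : GroupDistribution (SubgroupTower.diagonal 𝒰 href) ℂ_[p]) (c : I)
    (hE : ∀ (n : ℕ) (b : G ⧸ (𝒰 n).U n), (twisting (σ c) (Nm c : ℂ_[p]) E).μ n b = (i n (β n c)).μ n b)
    {C : ℝ} (hC0 : 0 ≤ C) (hC : ∀ m, (i m (β m c)).bound ≤ C)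
    (hcompat : ∀ (m n : ℕ) (a : G ⧸ (𝒰 m).U n),
      ((i (m + 1) (β (m + 1) c)).pushforward (MonoidHom.id G)
        (SubgroupTower.le_comap_id 𝒰 href m)).μ n a = (i m (β m c)).μ n a)
    (m : ℕ) {χ : G → ℂ_[p]} (hχc : (𝒰 m).IsTowerContinuous χ)
    (hχ : ∀ x y, χ (x * y) = χ x * χ y) (h1 : χ 1 = 1) (hne : χ (σ c) ≠ (Nm c : ℂ_[p])) :
    E.integral χ = (χ (σ c) - (Nm c : ℂ_[p]))⁻¹ * (i m (β m c)).integral χ := by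
  rw [integral_eq_of_glue i β σ Nm E c hE hC0 hC hcompat
      (SubgroupTower.IsTowerContinuous.diagonal_of href hχc) hχ h1 hne,
    integral_glue_eq (href := href) (fun m ↦ i m (β m c)) hC0 hC hcompat m hχc]

/-! ### §2. With the family INDUCED from subgroups `H_m ⊇ U^{(m)}_0`: the sum over `𝒢 ⧸ U^{(m)}_0` (II.4.7 (16)) -/

variable {H : ℕ → Subgroup G} {𝒱 : (m : ℕ) → SubgroupTower (H m)}
  (hV : ∀ m n, (𝒱 m).U n = ((𝒰 m).U n).subgroupOf (H m))
  [∀ m, CommMonoid (B m)] [∀ m, MulDistribMulAction G (B m)]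
  (iH : (m : ℕ) → B m → GroupDistribution (𝒱 m) ℂ_[p]) {C : ℝ} (hC0 : 0 ≤ C)
  (hC : ∀ m (b : B m), (iH m b).bound ≤ C)
  (β : (m : ℕ) → I → B m) (σ : I → G) (Nm : I → ℕ)

/-- ★★ **The integrals of the two-variable measure at the modulus `𝔣_m`, DECOMPOSED OVER `𝒢 ⧸ U^{(m)}_0`**
(II.4.14 (38) first line, with (29)↔(31) and II.4.7 (16)): for the induced families
`i_m = induceFrom i_{H_m}` (`H_m ⊇ U^{(m)}_0`, `i_{H_m}` a bounded family on `H_m` along the restricted tower),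
if `δ_{σ_𝔠,N𝔠} E = i_n(β_𝔠^{(n)})` at every level `n` and the `i_m(β_𝔠^{(m)})` are compatible under
coarsening, then for every `m` and every multiplicative `χ` with `χ(1) = 1`, continuous for `𝒰^{(m)}`,
`χ(σ_𝔠) ≠ N𝔠`:
**`∫_𝒢 χ dE = (χ(σ_𝔠) − N𝔠)⁻¹ · Σ_{c ∈ 𝒢/U^{(m)}_0} χ(r_c) · ∫_{H_m} 𝟙_{U^{(m)}_0} χ d i_{H_m}(r_c⁻¹ • β_𝔠^{(m)})`**
(de Shalit's `Σ_𝔠 χ(𝔠⁻¹) ∫_G … dμ_{σ_𝔠(β)}`, his `σ_𝔠 = r_c⁻¹`).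
[cite: deShalit1987, II.4.14 (38) (p. 71–72), II.4.12 (29)↔(31) (p. 67–69), II.4.7 (16) (p. 60)] -/
theorem integral_eq_sum_of_glue_induceFrom
    (E : GroupDistribution (SubgroupTower.diagonal 𝒰 href) ℂ_[p]) (c : I)
    (hE : ∀ (n : ℕ) (b : G ⧸ (𝒰 n).U n), (twisting (σ c) (Nm c : ℂ_[p]) E).μ n b =
      (induceFrom (hV n) (iH n) hC0 (hC n) (β n c)).μ n b)
    (hcompat : ∀ (m n : ℕ) (a : G ⧸ (𝒰 m).U n),
      ((induceFrom (hV (m + 1)) (iH (m + 1)) hC0 (hC (m + 1)) (β (m + 1) c)).pushforward (MonoidHom.id G)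
        (SubgroupTower.le_comap_id 𝒰 href m)).μ n a = (induceFrom (hV m) (iH m) hC0 (hC m) (β m c)).μ n a)
    (m : ℕ) {χ : G → ℂ_[p]} (hχc : (𝒰 m).IsTowerContinuous χ)
    (hχ : ∀ x y, χ (x * y) = χ x * χ y) (h1 : χ 1 = 1) (hne : χ (σ c) ≠ (Nm c : ℂ_[p])) :
    E.integral χ = (χ (σ c) - (Nm c : ℂ_[p]))⁻¹ *
      ∑ c' ∈ (𝒰 m).cells 0, χ ((𝒰 m).repr 0 c') * (iH m (((𝒰 m).repr 0 c')⁻¹ • β m c)).integral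
        (fun y : H m ↦ (if (𝒰 m).proj 0 (y : G) = 1 then (1 : ℂ_[p]) else 0) * χ y) := by
  rw [integral_eq_of_glue_at (href := href) (fun m b ↦ induceFrom (hV m) (iH m) hC0 (hC m) b) β σ Nm E c
      hE hC0 (fun _ ↦ le_rfl) hcompat m hχc hχ h1 hne,
    integral_induceFrom_of_mul (hV m) (iH m) hC0 (hC m) (β m c) hχc hχ]

/-- ★★ **The same when `H_m = U^{(m)}_0`** (indicator-free; de Shalit's `G` itself the top level — e.g.
`K(𝔣_m v) = K(𝔣_m)` at a degree-one `v ∣ 2`, II.4.17):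
**`∫_𝒢 χ dE = (χ(σ_𝔠) − N𝔠)⁻¹ · Σ_{c ∈ 𝒢/H_m} χ(r_c) · ∫_{H_m} χ d i_{H_m}(r_c⁻¹ • β_𝔠^{(m)})`**.
[cite: deShalit1987, II.4.14 (38) (p. 71–72), II.4.12 (29)↔(31) (p. 67–69), II.4.7 (16) (p. 60), II.4.17 (p. 77–78)] -/
theorem integral_eq_sum_of_glue_induceFrom_of_le
    (E : GroupDistribution (SubgroupTower.diagonal 𝒰 href) ℂ_[p]) (c : I)
    (hE : ∀ (n : ℕ) (b : G ⧸ (𝒰 n).U n), (twisting (σ c) (Nm c : ℂ_[p]) E).μ n b =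
      (induceFrom (hV n) (iH n) hC0 (hC n) (β n c)).μ n b)
    (hcompat : ∀ (m n : ℕ) (a : G ⧸ (𝒰 m).U n),
      ((induceFrom (hV (m + 1)) (iH (m + 1)) hC0 (hC (m + 1)) (β (m + 1) c)).pushforward (MonoidHom.id G)
        (SubgroupTower.le_comap_id 𝒰 href m)).μ n a = (induceFrom (hV m) (iH m) hC0 (hC m) (β m c)).μ n a)
    (m : ℕ) (hH' : H m ≤ (𝒰 m).U 0) {χ : G → ℂ_[p]} (hχc : (𝒰 m).IsTowerContinuous χ)
    (hχ : ∀ x y, χ (x * y) = χ x * χ y) (h1 : χ 1 = 1) (hne : χ (σ c) ≠ (Nm c : ℂ_[p])) :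
    E.integral χ = (χ (σ c) - (Nm c : ℂ_[p]))⁻¹ *
      ∑ c' ∈ (𝒰 m).cells 0, χ ((𝒰 m).repr 0 c') *
        (iH m (((𝒰 m).repr 0 c')⁻¹ • β m c)).integral (fun y : H m ↦ χ y) := by
  rw [integral_eq_of_glue_at (href := href) (fun m b ↦ induceFrom (hV m) (iH m) hC0 (hC m) b) β σ Nm E c
      hE hC0 (fun _ ↦ le_rfl) hcompat m hχc hχ h1 hne,
    integral_induceFrom_of_mul_of_le (hV m) (iH m) hC0 (hC m) hH' (β m c) hχc hχ]

end GroupDistribution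

end Literature.NumberTheory.EllipticCurves

end
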